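import Mathlib
import Summits.NavierStokesRegularity.NavierStokesRegularity.Theorems.ThreadingFluxHorizonTowerL2Quadrupole
import Summits.NavierStokesRegularity.NavierStokesRegularity.Theorems.ThreadingFluxHorizonTowerProfileStructure
import Summits.NavierStokesRegularity.NavierStokesRegularity.Theorems.ThreadingFluxHorizonTowerHomogeneousCubic
import HarnessLib

/-!
# Crux `PoloidalLiouville` (stmt-NavierStokesRegularity-1222, wall W1), crux idea «horizon-threading-tower» (ns-idea-15):
# `HorizonZonalitySingleDegree` at `l = 2`, BY NAME and unconditional

Support file (Theorems-side tooling; seat ns-wall-eng-4 g2, cell ns-wall-extremal, W1 adjunct; `--supports stmt-NavierStokesRegularity-1222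
--as helper`).  The degree-2 cell of the line's typed obstruction (ns-wall-crit-1 g2, 2026-08-28T22:13:52Z: «STAYS a price for l = 2 … cheap,
owed by whoever wants it»), paid in kernel:

* `HorizonTower.exists_quadForm_of_homogeneous_two` — a `C²` degree-2 homogeneous `H : ℝ³ → ℝ` is the quadratic form `⟪y, Qy⟫` of the symmetric
  operator `Q = ½ D(∇H)(0)` (top Taylor term, eng-7 g3's `factorial_mul_eq_iteratedFDeriv_of_homogeneous`);
* `HorizonTower.laplacian_quadForm_eq_trace` — `Δ⟪y, Qy⟫ = 2 tr Q`;
* `HorizonTower.inner_cross_eq_det` — `⟪x, u × w⟫ = det(x, u, w)`;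
* `HorizonTower.quadForm_zonal_of_det` — ★ the algebra: a symmetric traceless `Q` on `ℝ³` with `det(x, Qx, Q²x) = 0` for all `x` has two equal
  eigenvalues (Mathlib's spectral theorem `LinearMap.IsSymmetric.eigenvectorBasis`; a non-zero quadratic polynomial has at most two roots), hence
  `⟪y, Qy⟫ = λ(‖y‖² − 3⟪n, y⟫²)` for a unit eigenvector `n`: the ZONAL form `‖y‖² g(⟪n,y⟫/‖y‖)`, `g(s) = λ(1 − 3s²)`;
* ★ `HorizonTower.horizonZonality_degree_two` — **the `l = 2` cell of `HorizonZonalitySingleDegree`, UNCONDITIONAL**: a smooth degree-2 homogeneous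
  harmonic `H` whose horizon profile is annihilated by `𝔏₂` off the origin is zonal (via the table cell `horizonL2Quadrupole`, p673251:
  `𝔏₂[U_Q] = −256 det(x, Qx, Q²x)/‖x‖³`).

With `horizonZonality_degree_three` (p672708) the cells `l = 2, 3` of `HorizonZonalitySingleDegree` are tree theorems; `l ≥ 4` and the tower form
remain conjectures (reduced to det-zonality by `horizonZonalitySingleDegree_of_detZonal`, p673002).  HONEST LABEL: information-grade for W1/W2
(movement 0); `PoloidalLiouville` (1222), `UnthreadedRigidity` (27585) and NS regularity remain OPEN and untouched.  No `native_decide`.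
[cite: MajdaBertozziCUP2002, §1.1 (vector identities)]
-/

-- the summit and its single problem share the name (D-0017 nested layout)
set_option linter.dupNamespace false

noncomputable section

open Set Function Filter Topology
open scoped Topology RealInnerProductSpace
open Literature.Analysis.FluidPDE

namespace Summit.NavierStokesRegularity.NavierStokesRegularity.Theorems.PoloidalLiouville.HorizonTower

/-! ### A smooth degree-2 homogeneous function is a quadratic form -/

/-- **Top Taylor term, degree two**: a `C²` function with `H (c • y) = c² H y` is the quadratic form of the symmetric operator
`Q = ½ D(∇H)(0)`: `H y = ⟪y, Q y⟫`. [folklore] -/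
theorem exists_quadForm_of_homogeneous_two {H : E3 → ℝ} (hH : ContDiff ℝ 2 H)
    (hhom : ∀ (c : ℝ) (y : E3), H (c • y) = c ^ 2 * H y) :
    ∃ Q : E3 →L[ℝ] E3, (∀ a b : E3, ⟪Q a, b⟫ = ⟪a, Q b⟫) ∧ ∀ y : E3, H y = ⟪y, Q y⟫ := by
  have hH0 : ContDiffAt ℝ 2 H 0 := hH.contDiffAt
  -- `⟪D(∇H)(0) u, v⟫ = D²H(0)(u)(v)`
  have hD : DifferentiableAt ℝ (fderiv ℝ H) 0 :=
    (hH0.fderiv_right (m := 1) (by norm_num)).differentiableAt (by simp)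
  have hgrad : HasFDerivAt (gradient H)
      (((InnerProductSpace.toDual ℝ E3).symm : (E3 →L[ℝ] ℝ) →L[ℝ] E3).comp (fderiv ℝ (fderiv ℝ H) 0)) 0 :=
    (InnerProductSpace.toDual ℝ E3).symm.hasFDerivAt.comp 0 hD.hasFDerivAt
  have hcomp : ∀ u v : E3, ⟪fderiv ℝ (gradient H) 0 u, v⟫ = fderiv ℝ (fderiv ℝ H) 0 u v := by
    intro u v
    rw [hgrad.fderiv]
    exact InnerProductSpace.toDual_symm_apply
  have happ : ∀ a : E3, ((1 / 2 : ℝ) • fderiv ℝ (gradient H) 0) a = (1 / 2 : ℝ) • fderiv ℝ (gradient H) 0 a := fun a => rfl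
  refine ⟨(1 / 2 : ℝ) • fderiv ℝ (gradient H) 0, fun a b => ?_, fun y => ?_⟩
  · rw [happ, happ, real_inner_smul_left, real_inner_smul_right, inner_fderiv_gradient_symm hH0 a b, real_inner_comm]
  · have h2 := factorial_mul_eq_iteratedFDeriv_of_homogeneous hH hhom y
    rw [iteratedFDeriv_two_apply, ← hcomp] at h2
    rw [happ, real_inner_smul_right, real_inner_comm]
    norm_num [Nat.factorial] at h2
    linarith

/-- `Δ⟪y, Qy⟫ = 2 tr Q` for every `Q : ℝ³ →L ℝ³` (Laplacian from line restrictions). [folklore] -/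
theorem laplacian_quadForm_eq_trace (Q : E3 →L[ℝ] E3) (x : E3) :
    Laplacian.laplacian (fun y : E3 => ⟪y, Q y⟫) x = 2 * LinearMap.trace ℝ E3 (Q : E3 →ₗ[ℝ] E3) := by
  have h2 : ContDiff ℝ 2 (fun y : E3 => ⟪y, Q y⟫) := (contDiff_quadForm Q).of_le (by norm_cast)
  rw [laplacian_eq_sum_iteratedDeriv_line h2]
  have hline : ∀ m : Fin 3, iteratedDeriv 2 (fun t : ℝ => ⟪x + t • EuclideanSpace.single m (1 : ℝ),
      Q (x + t • EuclideanSpace.single m (1 : ℝ))⟫) 0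
      = 2 * ⟪(EuclideanSpace.single m (1 : ℝ) : E3), Q (EuclideanSpace.single m (1 : ℝ))⟫ := by
    intro m
    have hfun : (fun t : ℝ => ⟪x + t • EuclideanSpace.single m (1 : ℝ), Q (x + t • EuclideanSpace.single m (1 : ℝ))⟫)
        = fun t : ℝ => ⟪x, Q x⟫ + t * (⟪(EuclideanSpace.single m (1 : ℝ) : E3), Q x⟫ + ⟪x, Q (EuclideanSpace.single m (1 : ℝ))⟫)
          + t ^ 2 * ⟪(EuclideanSpace.single m (1 : ℝ) : E3), Q (EuclideanSpace.single m (1 : ℝ))⟫ + t ^ 3 * 0 := by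
      funext t
      rw [map_add, map_smul, inner_add_left, inner_add_right, inner_add_right, real_inner_smul_left, real_inner_smul_left,
        real_inner_smul_right, real_inner_smul_right]
      ring
    rw [hfun, iteratedDeriv_two_cubic]
  simp only [hline]
  rw [← Finset.mul_sum, LinearMap.trace_eq_sum_inner _ (EuclideanSpace.basisFun (Fin 3) ℝ)]
  simp

/-! ### `det(x, Qx, Q²x) ≡ 0` forces two equal eigenvalues: the quadratic form is zonal -/

/-- `⟪x, u × w⟫ = det(x, u, w)` (rows). [folklore] -/
theorem inner_cross_eq_det (x u w : E3) :
    ⟪x, cross u w⟫ = Matrix.det ![WithLp.ofLp x, WithLp.ofLp u, WithLp.ofLp w] := by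
  rw [Matrix.det_fin_three]
  simp only [cross, PiLp.inner_apply, RCLike.inner_apply, conj_trivial, Fin.sum_univ_three, cross_apply,
    Matrix.cons_val_zero, Matrix.cons_val_one, Matrix.cons_val_two, Matrix.head_cons, Matrix.tail_cons]
  ring

/-- ★ **A symmetric traceless operator on `ℝ³` with `det(x, Qx, Q²x) = 0` for every `x` has a zonal quadratic form**:
`⟪y, Qy⟫ = ‖y‖² g(⟪n, y⟫/‖y‖)` off the origin for some `n ≠ 0` (indeed `g(s) = λ(1 − 3s²)`, `n` a unit eigenvector: two eigenvalues
coincide because a non-zero polynomial of degree `≤ 2` cannot vanish at three distinct eigenvalues). [folklore] -/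
theorem quadForm_zonal_of_det (Q : E3 →L[ℝ] E3) (hQs : ∀ a b : E3, ⟪Q a, b⟫ = ⟪a, Q b⟫)
    (htr : LinearMap.trace ℝ E3 (Q : E3 →ₗ[ℝ] E3) = 0) (hdet : ∀ x : E3, ⟪x, cross (Q x) (Q (Q x))⟫ = 0) :
    ∃ (a : E3) (g : ℝ → ℝ), a ≠ 0 ∧ ∀ y : E3, y ≠ 0 → ⟪y, Q y⟫ = ‖y‖ ^ 2 * g (⟪a, y⟫ / ‖y‖) := by
  classical
  set T : E3 →ₗ[ℝ] E3 := (Q : E3 →ₗ[ℝ] E3) with hT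
  have hTs : T.IsSymmetric := fun u v => hQs u v
  have hn : Module.finrank ℝ E3 = 3 := finrank_euclideanSpace_fin
  set b : OrthonormalBasis (Fin 3) ℝ E3 := hTs.eigenvectorBasis hn with hb
  set μ : Fin 3 → ℝ := hTs.eigenvalues hn with hμ
  have hQb : ∀ i : Fin 3, Q (b i) = μ i • b i := fun i => by
    have h : T (b i) = (RCLike.ofReal (μ i) : ℝ) • b i := hTs.apply_eigenvectorBasis hn i
    simpa [hT] using h
  have hQQb : ∀ i : Fin 3, Q (Q (b i)) = (μ i ^ 2) • b i := fun i => by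
    rw [hQb, map_smul, hQb, smul_smul, pow_two]
  -- trace = sum of eigenvalues
  have hsum : μ 0 + μ 1 + μ 2 = 0 := by
    have h := hTs.trace_eq_sum_eigenvalues hn
    rw [Fin.sum_univ_three] at h
    have h' : LinearMap.trace ℝ E3 T = 0 := htr
    rw [h'] at h
    simpa [hμ] using h.symm
  -- the quadratic form and the norm in the eigenbasis
  have hexpand : ∀ y : E3, ⟪y, Q y⟫ = μ 0 * ⟪b 0, y⟫ ^ 2 + μ 1 * ⟪b 1, y⟫ ^ 2 + μ 2 * ⟪b 2, y⟫ ^ 2 := by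
    intro y
    have hQy : Q y = ∑ m : Fin 3, (⟪b m, y⟫ * μ m) • b m := by
      conv_lhs => rw [← b.sum_repr' y]
      rw [map_sum]
      refine Finset.sum_congr rfl fun m _ => ?_
      rw [map_smul, hQb, smul_smul]
    rw [hQy, inner_sum, Fin.sum_univ_three, real_inner_smul_right, real_inner_smul_right, real_inner_smul_right,
      real_inner_comm (b 0) y, real_inner_comm (b 1) y, real_inner_comm (b 2) y]
    ring
  have hnorm : ∀ y : E3, ‖y‖ ^ 2 = ⟪b 0, y⟫ ^ 2 + ⟪b 1, y⟫ ^ 2 + ⟪b 2, y⟫ ^ 2 := fun y => by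
    rw [← b.sum_sq_inner_right y, Fin.sum_univ_three]
  -- two eigenvalues coincide
  have key : μ 0 = μ 1 ∨ μ 0 = μ 2 ∨ μ 1 = μ 2 := by
    by_contra hne
    have hne01 : μ 0 ≠ μ 1 := fun h => hne (Or.inl h)
    have hne02 : μ 0 ≠ μ 2 := fun h => hne (Or.inr (Or.inl h))
    have hne12 : μ 1 ≠ μ 2 := fun h => hne (Or.inr (Or.inr h))
    set x₀ : E3 := b 0 + b 1 + b 2 with hx₀
    have hx₀sum : x₀ = ∑ j : Fin 3, (fun _ => (1 : ℝ)) j • b j := by simp [hx₀, Fin.sum_univ_three]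
    have hQx : Q x₀ = ∑ j : Fin 3, (fun j => μ j) j • b j := by
      simp [hx₀, Fin.sum_univ_three, map_add, hQb]
    have hQQx : Q (Q x₀) = ∑ j : Fin 3, (fun j => μ j ^ 2) j • b j := by
      simp [hx₀, Fin.sum_univ_three, map_add, hQQb]
    -- the triple product vanishes, so the three rows are linearly dependent
    have hd : Matrix.det ![WithLp.ofLp x₀, WithLp.ofLp (Q x₀), WithLp.ofLp (Q (Q x₀))] = 0 := by
      rw [← inner_cross_eq_det]; exact hdet x₀
    obtain ⟨v, hv0, hvM⟩ := Matrix.exists_vecMul_eq_zero_iff.mpr hd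
    have hvec : v 0 • x₀ + v 1 • Q x₀ + v 2 • Q (Q x₀) = 0 := by
      ext j
      have hj := congrFun hvM j
      simp only [Matrix.vecMul, dotProduct, Fin.sum_univ_three, Matrix.cons_val_zero, Matrix.cons_val_one,
        Matrix.cons_val_two, Matrix.head_cons, Matrix.tail_cons, Pi.zero_apply] at hj
      simp only [PiLp.add_apply, PiLp.smul_apply, smul_eq_mul, PiLp.zero_apply]
      linarith
    -- pair with each eigenvector: `v₀ + v₁ μₘ + v₂ μₘ² = 0`
    have hpoly : ∀ m : Fin 3, v 0 + v 1 * μ m + v 2 * μ m ^ 2 = 0 := by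
      intro m
      have h := congrArg (fun z : E3 => ⟪b m, z⟫) hvec
      simp only [inner_add_right, real_inner_smul_right, inner_zero_right] at h
      rw [hQQx, hQx, hx₀sum, b.orthonormal.inner_right_fintype, b.orthonormal.inner_right_fintype,
        b.orthonormal.inner_right_fintype] at h
      linarith
    have h01 : v 1 + v 2 * (μ 0 + μ 1) = 0 := by
      have e : (μ 0 - μ 1) * (v 1 + v 2 * (μ 0 + μ 1)) = 0 := by linear_combination hpoly 0 - hpoly 1
      rcases mul_eq_zero.mp e with h | h
      · exact absurd (sub_eq_zero.mp h) hne01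
      · exact h
    have h02 : v 1 + v 2 * (μ 0 + μ 2) = 0 := by
      have e : (μ 0 - μ 2) * (v 1 + v 2 * (μ 0 + μ 2)) = 0 := by linear_combination hpoly 0 - hpoly 2
      rcases mul_eq_zero.mp e with h | h
      · exact absurd (sub_eq_zero.mp h) hne02
      · exact h
    have hv2 : v 2 = 0 := by
      have e : (μ 1 - μ 2) * v 2 = 0 := by linear_combination h01 - h02
      rcases mul_eq_zero.mp e with h | h
      · exact absurd (sub_eq_zero.mp h) hne12
      · exact h
    have hv1 : v 1 = 0 := by rw [hv2] at h01; linarith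
    have hv00 : v 0 = 0 := by have h := hpoly 0; rw [hv1, hv2] at h; linarith
    apply hv0
    funext m
    fin_cases m
    · exact hv00
    · exact hv1
    · exact hv2
  -- the zonal form about the third eigenvector: `⟪y, Qy⟫ = c‖y‖² − 3c⟪b k, y⟫²`
  have hcore : ∀ (k : Fin 3) (c : ℝ), (∀ y : E3, ⟪y, Q y⟫ = c * ‖y‖ ^ 2 - 3 * c * ⟪b k, y⟫ ^ 2) →
      ∃ (a : E3) (g : ℝ → ℝ), a ≠ 0 ∧ ∀ y : E3, y ≠ 0 → ⟪y, Q y⟫ = ‖y‖ ^ 2 * g (⟪a, y⟫ / ‖y‖) := by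
    intro k c hform
    refine ⟨b k, fun s => c * (1 - 3 * s ^ 2), ?_, fun y hy => ?_⟩
    · intro h0
      have h1 : ‖b k‖ = 1 := b.orthonormal.1 k
      rw [h0, norm_zero] at h1
      exact zero_ne_one h1
    · have hr : ‖y‖ ≠ 0 := norm_ne_zero_iff.2 hy
      rw [hform y]
      field_simp
  rcases key with h | h | h
  · -- μ₀ = μ₁, axis b₂
    refine hcore 2 (μ 0) fun y => ?_
    rw [hexpand, hnorm]
    have hμ2 : μ 2 = -2 * μ 0 := by linarith
    rw [← h, hμ2]
    ring
  · -- μ₀ = μ₂, axis b₁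
    refine hcore 1 (μ 0) fun y => ?_
    rw [hexpand, hnorm]
    have hμ1 : μ 1 = -2 * μ 0 := by linarith
    rw [← h, hμ1]
    ring
  · -- μ₁ = μ₂, axis b₀
    refine hcore 0 (μ 1) fun y => ?_
    rw [hexpand, hnorm]
    have hμ0 : μ 0 = -2 * μ 1 := by linarith
    rw [← h, hμ0]
    ring

/-! ### The `l = 2` cell of `HorizonZonalitySingleDegree` -/

/-- ★ **`HorizonZonalitySingleDegree` at `l = 2`, UNCONDITIONAL.**  A smooth degree-2 homogeneous harmonic `H : ℝ³ → ℝ` whose horizon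
profile `horizonProfile 2 H 0` is annihilated by the order-two horizon law off the origin has the zonal form
`H(y) = ‖y‖² g(⟪n, y⟫/‖y‖)` — literally the body of `HorizonTower.HorizonZonalitySingleDegree` with `l := 2`.  Chain: `H = ⟪y, Qy⟫`
(`exists_quadForm_of_homogeneous_two`), `tr Q = 0` (harmonic, `laplacian_quadForm_eq_trace`), table cell `horizonL2Quadrupole` (p673251):
`𝔏₂ = −256 det(x, Qx, Q²x)/‖x‖³`, and `quadForm_zonal_of_det` (continuity at `x = 0`). -/
theorem horizonZonality_degree_two (H : E3 → ℝ) (hH : ContDiff ℝ (⊤ : ℕ∞) H)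
    (hhom : ∀ (c : ℝ) (y : E3), H (c • y) = c ^ 2 * H y) (hΔ : ∀ y : E3, Laplacian.laplacian H y = 0)
    (hL2 : ∀ x : E3, x ≠ 0 → horizonL2 (horizonProfile 2 H 0) 0 x = 0) :
    ∃ (a : E3) (g : ℝ → ℝ), a ≠ 0 ∧ ∀ y : E3, y ≠ 0 → H y = ‖y‖ ^ 2 * g (inner ℝ a y / ‖y‖) := by
  obtain ⟨Q, hQs, hHQ⟩ := exists_quadForm_of_homogeneous_two (hH.of_le (by norm_cast)) hhom
  have hHQ' : H = fun y : E3 => ⟪y, Q y⟫ := funext hHQ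
  -- traceless
  have htr : LinearMap.trace ℝ E3 (Q : E3 →ₗ[ℝ] E3) = 0 := by
    have h := laplacian_quadForm_eq_trace Q 0
    rw [← hHQ', hΔ 0] at h
    linarith
  have hshape : IsShapeTensor Q := ⟨hQs, htr⟩
  -- the determinant vanishes off the origin, hence everywhere
  have hdet : ∀ x : E3, ⟪x, cross (Q x) (Q (Q x))⟫ = 0 := by
    intro x
    by_cases hx : x = 0
    · rw [hx, inner_zero_left]
    · have h := hL2 x hx
      rw [hHQ', horizonL2Quadrupole Q hshape x hx] at h
      have hr : ‖x‖ ^ 3 ≠ 0 := pow_ne_zero _ (norm_ne_zero_iff.2 hx)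
      rcases div_eq_zero_iff.mp h with h1 | h1
      · rcases mul_eq_zero.mp h1 with h2 | h2
        · norm_num at h2
        · exact h2
      · exact absurd h1 hr
  obtain ⟨a, g, ha, hg⟩ := quadForm_zonal_of_det Q hQs htr hdet
  exact ⟨a, g, ha, fun y hy => by rw [hHQ y]; exact hg y hy⟩

end Summit.NavierStokesRegularity.NavierStokesRegularity.Theorems.PoloidalLiouville.HorizonTower

end
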